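import Summits.Schanuel.Schanuel.Theorems.RootDecomp1KExhibitDescent01

/-!
# RootDecomp1KExhibitDescent — lens 1, generation 69, NODE 29 «BOTH EXHIBITS OF RECORD FALL TO DESCENT» (×0-AS-RECORD, PRICE L3091; ERRATUM E6; CLAIM L3089, NODE L3094, VERDICT L3096): ρ1′ = `rho1'` = (Y + 1)(Y³ + x) − 17x² LEVEL-EMPTY for N ≥ 4 by the coprime SPLIT DESCENT + the digit mod 32 (class `splitC t c = (Y + t)(Y³ + x) − c·x²`, t = ±2^i, c an odd prime ≢ 1 mod 32: `no_level_splitC`, `thinFibreAt_rho1'`) and ρ2′ = `rho2'` = (Y² − 17x)² − x(Y + 1) LEVEL-FINITE by the SQUARE DESCENT p_N = □ + the tree's x-linear Ridout member (class `sqTopC c a b = (Y² − c·x)² + x(aY + b)`, c odd, b ≠ 0: `levelSet_sqTopC_subset ⊆ {N < 2} ∪ SqLevels b c`, `thinFibreAt_rho2'`); exhibits of record VACANT thereafter — continuation (RootDecomp1KExhibitDescent02): # The exhibit of record ρ1′ = `rho1'` = `S(1,17)` = `(Y + 1)(Y³ + x) − 17·x²` — DECIDED · §3  SQUARE DESCENT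 — the class `Q(c,a,b) = (Y² − c·x)² + x·(a·Y + b)` and the exhibit of record ρ2′ = `Q(17,−1 · # The exhibit of record ρ2′ = `rho2'` = `Q(17,−1,−1)` = `(Y² − 17x)² − x·Y − x` — DECIDED — 36 declarations `thinFibreAt_split` … `rho2'_eq_sqTopC`

(lens-1 g69 NODE 29 «BOTH EXHIBITS OF RECORD FALL TO DESCENT» L3094: HOME kernel K = HOME/decomp-schanuel-lens-1/g69/lean/ExhibitDescent.lean sha256 b5df7c6e…, 777 l, 53 decls (50 theorems + 3 defs `splitC` / `SqLevels` / `sqTopC`), ONE namespace `Summit.Schanuel.Schanuel.Theorems.RootDecomp1KExhibitDescent`, imports the tree port …RootDecomp1KResidueDescent04 ONLY (node 28's record port; `rho1'` / `rho2'` / `residue_rho1'` / `residue_rho2'` / `pow_eight_mod` / `cube_mod` / `level_exponent` / `two_pow_dvd_psNumer_sub_one` / `levelFinite_xLinear` BY TREE NAME); no private / instance / set_option / notation / sorry / new axiom / binder, `decide` only on small literals; lens farm rc 0 · 0 errors · 0 sorries · 53 dupNamespace, `--axioms` standard ×20, Probe g69/out/Probe.lean 62ee5499… rc 0 (control ProbeCtrl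 rc 1 as it must), memo g69/NODE-g69.md; CLAIM L3089 (ASK-FIRST under K-R58 (iii)); crit g12 PRICE L3091: ×0-AS-RECORD («ρ1′ lever = DESCENT ∪ LOCAL SIEVING; ρ2′ lever = DESCENT ∪ the tree's isSquare_mul_psNumer_finite — a toolkit member»), CHECKLIST K-g69 (G1)–(G5) + (S), ERRATUM E6 PRE-ANNOUNCED ((E6-a) the census K-R51 (ii) descent-datum keys = the admission screen for exhibits; (E6-b) ρ1′ / ρ2′ leave the exhibit list at this port — exhibits VACANT; (E6-d) the critic's own erratum on VERDICT 28), W-29-1 (genus ≥ 2 guidance); writer g36 pre-check NOTE 1 L3093 (40/40); census INSTRUMENT NOTE 45 L3090 (the LIVENESS-v38/v39 keys on ρ1′ / ρ2′: jroot(3) not excluded, tors ∣ 3 / j2rat SOME, tors ∣ 4 — «K-R51 certificate INCOMPLETE» at nomination); (G2) deviation of record: K proves `isSquare_mul_psNumer_finite'` from the TREE's `levelFinite_xLinear (X^2) (−C e)` because the tree's `isSquare_mul_psNumer_finite` (DegreeLadder09) is outside the import closure; crit g12 VERDICT 29 L3096: «×0-AS-RECORD — BOOKED (no credit: exhibits,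 classes, cores); CHECKLIST K-g69 (G1)–(G5) + (S) MET, the (G2) deviation ACCEPTED; ERRATUM E6 — FIXED ((E6-a) the census descent-datum keys = the admission screen, with the census precision: xdeg-2 rows = the K-R51 (ii) battery ∧ not bi-pure ∧ DomZero ∧ typed ρ1/ρ2 residue member, xdeg ≥ 3 rows need the kit jac first; (E6-b) ρ1′ / ρ2′ LEAVE the exhibit list at this port and JOIN the unconditional part, EXHIBITS OF RECORD := VACANT (ρ1: vacant · ρ2: vacant); (E6-c) standing-witness ledger and tally UNCHANGED; (E6-d) the critic own erratum on VERDICT 28); TOOLKIT ∪= split descent {isCoprime_split, core_split, …splitC} and square descent {core_sq, level_sq_cases, SqLevels, …sqTopC, isSquare_mul_psNumer_finite′}; e29-1; PORT GO (STAGING NOTE 27 plan APPROVED AS STAGED)»; lens g69 RESULT/DONE L3097. Port by census-1 gen 25 as `RootDecomp1KExhibitDescent01–03` (files ≤ 400 lines; `--supports stmt-Schanuel-33364`, the item stays OPEN; ×0 record port, no credit anywhere; UNCONDITIONAL PART ∪= these names; E6: exhibits VACANT): 01 = K l.1–391 of the prepped source (opens §1 / §2) — 10 decls `int_eq6`, `shape6`,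 `noOddPrimeFactor_one`, …, `levelFinite_split`; 02 = K l.392–721 of the prepped source (opens # The exhibit of record ρ1′ = `rho1'` = `S(1,17)` = `(Y + 1)(Y³ + x) − 17·x²` — DECIDED / §3 / # The exhibit of record ρ2′ = `rho2'` = `Q(17,−1,−1)` = `(Y² − 17x)² − x·Y − x` — DECIDED) — 36 decls `thinFibreAt_split`, `splitC`, `splitC_zero`, …, `rho2'_eq_sqTopC`; 03 = K l.722–774 of the prepped source (opens §4) — 7 decls `bev_rho2'_sq`, `levelSet_rho2'_subset`, `levelFinite_rho2'`, …, `exhibits_decided`. 0 one-line docstrings synthesised for undocumented helper declarations (statements quoted); everything else = K VERBATIM (statements, names, proofs, K's module docstring kept in part 01 below this provenance block).)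
-/

noncomputable section

namespace Summit.Schanuel.Schanuel.Theorems.RootDecomp1KExhibitDescent

open Polynomial LiouvilleNumber
open scoped Nat
open Summit.Schanuel.Schanuel.Theorems.RootDecomp1KTwoBaseCell (psNumer partialSum_eq_psNumer_div coprime_psNumer)
open Summit.Schanuel.Schanuel.Theorems.RootDecomp1KDegreeLadder
open Summit.Schanuel.Schanuel.Theorems.RootDecomp1KXLinear (xLinP bev_xLinP thinFibreAt_xLinear)
open Summit.Schanuel.Schanuel.Theorems.RootDecomp1KXTop
open Summit.Schanuel.Schanuel.Theorems.RootDecomp1KLevelFinite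
open Summit.Schanuel.Schanuel.Theorems.RootDecomp1KOddEmpty (levelFinite_of_no_level)
open Summit.Schanuel.Schanuel.Theorems.RootDecomp1KHeightGrading (BddLevelEmpty bddLevelEmpty_iff_levelFinite)
open Summit.Schanuel.Schanuel.Theorems.RootDecomp1KDigitPincer (odd_psNumer_two two_pow_dvd_of_dvd_mul_odd)
open Summit.Schanuel.Schanuel.Theorems.RootDecomp1KTrinomialDescent (partialSum_two_eq_int_div)
open Summit.Schanuel.Schanuel.Theorems.RootDecomp1KRunge (psNumer_pos_runge)
open Summit.Schanuel.Schanuel.Theorems.RootDecomp1KSectorTheorem (Residue SectorCond rho1 rho2 levelFinite_xLinear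
  levelFinite_of_thinFibreAt_zero)
open Summit.Schanuel.Schanuel.Theorems.RootDecomp1KResidueDescent

/-- **`ThinFibreAt m₀` at EVERY quality `m₀` for the split class** — hypothesis-free. -/
theorem thinFibreAt_split {c t : ℤ} (hc : Prime c) (hodd : Odd c) (h32 : ¬ (32 : ℤ) ∣ c - 1)
    (ht : ∀ q : ℕ, q.Prime → (q : ℤ) ∣ t → q = 2) {P : ℤ[X][X]}
    (hP : ∀ x y, bev P x y = y ^ 4 + t * y ^ 3 + x * y + t * x - c * x ^ 2) (m₀ : ℕ) : ThinFibreAt m₀ P :=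
  thinFibreAt_of_levelFinite (levelFinite_split hc hodd h32 ht hP) m₀

/-- the split class as an x-coefficient vector: `c₀ = Y⁴ + t·Y³`, `c₁ = Y + t`, `c₂ = −c`. -/
def splitC (t c : ℤ) (j : ℕ) : ℤ[X] :=
  if j = 0 then X ^ 4 + C t * X ^ 3 else if j = 1 then X + C t else if j = 2 then C (-c) else 0

/-- `: splitC t c 0 = X ^ 4 + C t * X ^ 3`. -/
theorem splitC_zero (t c : ℤ) : splitC t c 0 = X ^ 4 + C t * X ^ 3 := by simp [splitC]
/-- `: splitC t c 1 = X + C t`. -/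
theorem splitC_one (t c : ℤ) : splitC t c 1 = X + C t := by simp [splitC]
/-- `: splitC t c 2 = C (-c)`. -/
theorem splitC_two (t c : ℤ) : splitC t c 2 = C (-c) := by simp [splitC]

/-- `S(t,c)(x, y) = y⁴ + t·y³ + x·y + t·x − c·x² = (y + t)(y³ + x) − c·x²`. -/
theorem bev_splitC (t c : ℤ) (x y : ℝ) :
    bev (xPolyP 2 (splitC t c)) x y = y ^ 4 + t * y ^ 3 + x * y + t * x - c * x ^ 2 := by
  rw [bev_xPolyP]
  simp [Finset.sum_range_succ, splitC_zero, splitC_one, splitC_two]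
  ring

/-- **no level point of `xPolyP 2 (splitC t c)` at `N ≥ 4`.** -/
theorem no_level_splitC {c t : ℤ} (hc : Prime c) (hodd : Odd c) (h32 : ¬ (32 : ℤ) ∣ c - 1)
    (ht : ∀ q : ℕ, q.Prime → (q : ℤ) ∣ t → q = 2) {N : ℕ} (hN : 4 ≤ N) (r : ℚ) :
    bev (xPolyP 2 (splitC t c)) (partialSum 2 N) r ≠ 0 :=
  no_level_split hc hodd h32 ht (bev_splitC t c) hN r

/-- **`LevelFinite (xPolyP 2 (splitC t c))`.** -/
theorem levelFinite_splitC {c t : ℤ} (hc : Prime c) (hodd : Odd c) (h32 : ¬ (32 : ℤ) ∣ c - 1)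
    (ht : ∀ q : ℕ, q.Prime → (q : ℤ) ∣ t → q = 2) : LevelFinite (xPolyP 2 (splitC t c)) :=
  levelFinite_split hc hodd h32 ht (bev_splitC t c)

/-- **`ThinFibreAt m₀ (xPolyP 2 (splitC t c))` for every `m₀`.** -/
theorem thinFibreAt_splitC {c t : ℤ} (hc : Prime c) (hodd : Odd c) (h32 : ¬ (32 : ℤ) ∣ c - 1)
    (ht : ∀ q : ℕ, q.Prime → (q : ℤ) ∣ t → q = 2) (m₀ : ℕ) : ThinFibreAt m₀ (xPolyP 2 (splitC t c)) :=
  thinFibreAt_split hc hodd h32 ht (bev_splitC t c) m₀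

/-! ### The exhibit of record ρ1′ = `rho1'` = `S(1,17)` = `(Y + 1)(Y³ + x) − 17·x²` — DECIDED -/

/-- the TREE's `rho1'` IS the member `splitC 1 17` of the split class (coefficient vectors equal). -/
theorem rho1'_eq_splitC : rho1' = splitC 1 17 := by
  funext j; simp only [rho1', splitC, map_one, one_mul]

/-- ρ1′ presents the split class with `t = 1`, `c = 17`. -/
theorem bev_rho1'_split (x y : ℝ) :
    bev (xPolyP 2 rho1') x y = y ^ 4 + ((1 : ℤ) : ℝ) * y ^ 3 + x * y + ((1 : ℤ) : ℝ) * x - ((17 : ℤ) : ℝ) * x ^ 2 := by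
  rw [bev_rho1']; push_cast; ring

/-- **THE EXHIBIT OF RECORD ρ1′ HAS NO LEVEL POINT AT ANY LEVEL `N ≥ 4`** (hypothesis-free). -/
theorem no_level_rho1' {N : ℕ} (hN : 4 ≤ N) (r : ℚ) : bev (xPolyP 2 rho1') (partialSum 2 N) r ≠ 0 :=
  no_level_split prime_seventeen (by decide) not_dvd_sixteen noOddPrimeFactor_one bev_rho1'_split hN r

/-- `(C : ℝ) : LevelSet (xPolyP 2 rho1') C ⊆ {N | N < 4}`. -/
theorem levelSet_rho1'_subset (C : ℝ) : LevelSet (xPolyP 2 rho1') C ⊆ {N | N < 4} :=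
  levelSet_split_subset prime_seventeen (by decide) not_dvd_sixteen noOddPrimeFactor_one bev_rho1'_split C

/-- **`LevelFinite rho1'`** (hypothesis-free). -/
theorem levelFinite_rho1' : LevelFinite (xPolyP 2 rho1') :=
  levelFinite_split prime_seventeen (by decide) not_dvd_sixteen noOddPrimeFactor_one bev_rho1'_split

/-- **`BddLevelEmpty rho1'`** (the B-side currency). -/
theorem bddLevelEmpty_rho1' : BddLevelEmpty (xPolyP 2 rho1') :=
  (bddLevelEmpty_iff_levelFinite _).mpr levelFinite_rho1'

/-- **`ThinFibreAt m₀ rho1'` for EVERY `m₀`** — in particular at the residue qualities `m₀ ≤ 2` of `residue_rho1'`. -/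
theorem thinFibreAt_rho1' (m₀ : ℕ) : ThinFibreAt m₀ (xPolyP 2 rho1') :=
  thinFibreAt_of_levelFinite levelFinite_rho1' m₀

/-- `: ThinFibreAt 2 (xPolyP 2 rho1')`. -/
theorem thinFibreAt_two_rho1' : ThinFibreAt 2 (xPolyP 2 rho1') := thinFibreAt_rho1' 2

/-! ## §3  SQUARE DESCENT — the class `Q(c,a,b) = (Y² − c·x)² + x·(a·Y + b)` and the exhibit of record ρ2′ = `Q(17,−1,−1)` -/

/-- **SQUARE CORE** (no hypothesis on `c`): an integer solution of `(W² − c·p)² = −p·2^m·(a·W + b·2^m)` with `p > 0`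
forces EITHER the degenerate branch `a·W + b·2^m = 0` (and then `c·p = □`) OR: every odd prime `q ∤ b` divides `p` to
an EVEN power
(`q ∣ p ⟹ q ∣ W ⟹ q ∤ a·W + b·2^m`, and `2·v_q(W² − c·p) = v_q(p) + v_q(2^m) + v_q(a·W + b·2^m) = v_q(p)`). -/
theorem core_sq {c a b : ℤ} {m : ℕ} {W p : ℤ} (hp0 : 0 < p)
    (h : (W ^ 2 - c * p) ^ 2 = -(p * 2 ^ m * (a * W + b * 2 ^ m))) :
    (a * W + b * 2 ^ m = 0 ∧ IsSquare (c * p)) ∨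
      ∀ q : ℕ, q.Prime → q ≠ 2 → ¬ (q : ℤ) ∣ b → Even (padicValInt q p) := by
  by_cases hL : a * W + b * 2 ^ m = 0
  · left
    rw [hL, mul_zero, neg_zero] at h
    have hW : W ^ 2 - c * p = 0 := pow_eq_zero_iff two_ne_zero |>.mp h
    exact ⟨hL, W, by linear_combination -hW⟩
  · right
    intro q hq hq2 hqb
    haveI := Fact.mk hq
    have hqZ : Prime (q : ℤ) := Nat.prime_iff_prime_int.mp hq
    have hq_two : ¬ (q : ℤ) ∣ 2 := fun h22 => by
      have : q ∣ 2 := by exact_mod_cast h22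
      exact hq2 ((Nat.prime_dvd_prime_iff_eq hq Nat.prime_two).mp this)
    by_cases hqp : (q : ℤ) ∣ p
    · have hqW : (q : ℤ) ∣ W := by
        have h1 : (q : ℤ) ∣ (W ^ 2 - c * p) ^ 2 := by
          rw [h]; exact dvd_neg.mpr (dvd_mul_of_dvd_left (dvd_mul_of_dvd_left hqp _) _)
        have h2 : (q : ℤ) ∣ W ^ 2 - c * p := hqZ.dvd_of_dvd_pow h1
        have h3 : (q : ℤ) ∣ W ^ 2 := by
          have := dvd_add h2 (dvd_mul_of_dvd_right hqp c)
          simpa using this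
        exact hqZ.dvd_of_dvd_pow h3
      have hqL : ¬ (q : ℤ) ∣ a * W + b * 2 ^ m := fun hd => by
        have hb2 : (q : ℤ) ∣ b * 2 ^ m := by
          have := dvd_sub hd (dvd_mul_of_dvd_right hqW a)
          simpa using this
        rcases hqZ.dvd_or_dvd hb2 with hb' | h2'
        · exact hqb hb'
        · exact hq_two (hqZ.dvd_of_dvd_pow h2')
      have hq2m : ¬ (q : ℤ) ∣ 2 ^ m := fun h2' => hq_two (hqZ.dvd_of_dvd_pow h2')
      have hA0 : W ^ 2 - c * p ≠ 0 := fun h0 => by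
        rw [h0] at h
        have h00 : p * 2 ^ m * (a * W + b * 2 ^ m) = 0 := by linear_combination h
        rcases mul_eq_zero.mp h00 with h1 | h1
        · rcases mul_eq_zero.mp h1 with h1 | h1
          · exact hp0.ne' h1
          · exact pow_ne_zero _ two_ne_zero h1
        · exact hL h1
      have h2m0 : (2 : ℤ) ^ m ≠ 0 := pow_ne_zero _ two_ne_zero
      have h' : (W ^ 2 - c * p) * (W ^ 2 - c * p) = p * 2 ^ m * (-(a * W + b * 2 ^ m)) := by
        linear_combination h
      have hv := congrArg (padicValInt q) h'
      rw [padicValInt.mul hA0 hA0, padicValInt.mul (mul_ne_zero hp0.ne' h2m0) (neg_ne_zero.mpr hL),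
        padicValInt.mul hp0.ne' h2m0, padicValInt.eq_zero_of_not_dvd hq2m,
        show padicValInt q (-(a * W + b * 2 ^ m)) = 0 from
          padicValInt.eq_zero_of_not_dvd (fun hd => hqL (dvd_neg.mp hd))] at hv
      exact ⟨padicValInt q (W ^ 2 - c * p), by omega⟩
    · rw [padicValInt.eq_zero_of_not_dvd hqp]; exact ⟨0, rfl⟩

/-- From «every odd prime `q ∤ b` divides `p` to an even power» (`p > 0` odd, `b ≠ 0`) to «`e·|p| = □` for some
ODD `e ∣ |b|`»: `e` is the squarefree kernel of `p`, and each of its primes is odd and must divide `b`. -/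
theorem exists_odd_dvd_isSquare {b p : ℤ} (hb : b ≠ 0) (hp0 : 0 < p) (hpodd : Odd p)
    (hv : ∀ q : ℕ, q.Prime → q ≠ 2 → ¬ (q : ℤ) ∣ b → Even (padicValInt q p)) :
    ∃ e : ℕ, Odd e ∧ e ∣ b.natAbs ∧ IsSquare (e * p.natAbs) := by
  obtain ⟨e, s, he0, hs0, hes, hsq⟩ := Nat.sq_mul_squarefree_of_pos (Int.natAbs_pos.mpr hp0.ne')
  have hpn_odd : Odd p.natAbs := Int.natAbs_odd.mpr hpodd
  have he_odd : Odd e := hpn_odd.of_dvd_nat ⟨s ^ 2, by rw [← hes]; ring⟩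
  refine ⟨e, he_odd, ?_, ⟨e * s, by rw [← hes]; ring⟩⟩
  rw [← Nat.factorization_le_iff_dvd he0.ne' (Int.natAbs_ne_zero.mpr hb), Finsupp.le_def]
  intro q
  by_cases hq : q.Prime
  · by_cases hqe : q ∣ e
    · have h1 : e.factorization q ≤ 1 := hsq.natFactorization_le_one q
      have hqb : q ∣ b.natAbs := by
        by_contra hqb
        have hqbZ : ¬ (q : ℤ) ∣ b := fun h => hqb (Int.ofNat_dvd_left.mp h)
        have hq2 : q ≠ 2 := by
          rintro rfl
          exact Nat.not_even_iff_odd.mpr he_odd (even_iff_two_dvd.mpr hqe)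
        have hev := hv q hq hq2 hqbZ
        haveI := Fact.mk hq
        have hval : padicValInt q p = p.natAbs.factorization q := by
          rw [Nat.factorization_def _ hq]; rfl
        have hpos : 0 < e.factorization q := hq.factorization_pos_of_dvd he0.ne' hqe
        have he1 : e.factorization q = 1 := le_antisymm h1 hpos
        rw [← hes, Nat.factorization_mul (pow_ne_zero _ hs0.ne') he0.ne', Nat.factorization_pow] at hval
        simp only [Finsupp.coe_add, Finsupp.coe_smul, Pi.add_apply, Pi.smul_apply, smul_eq_mul, he1] at hval
        rw [hval] at hev
        exact Nat.not_even_iff_odd.mpr ⟨s.factorization q, rfl⟩ hev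
      exact h1.trans (hq.factorization_pos_of_dvd (Int.natAbs_ne_zero.mpr hb) hqb)
    · simp [Nat.factorization_eq_zero_of_not_dvd hqe]
  · simp [Nat.factorization_eq_zero_of_not_prime _ hq]

/-- **The Ridout square set through the K-line's x-linear engine**: for every `e ≠ 0`, `{N : e·p_N = □}` is FINITE
(hypothesis-free).  (`isSquare_mul_psNumer_finite` of DegreeLadder part 09 — odd `e` — is not in the import closure of
the exhibits' module `…ResidueDescent04`; the conic `Y² = e·x` is the x-linear curve `xLinP (Y²) (−e)` of pole gap `2`,
whose level finiteness `levelFinite_xLinear` (node 27 part 10; node 2's engine, Ridout BY TREE NAME) is: a square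
`e·p_N = k²` at a level `N ≥ 2`, `N! = 2m`, is the rational point `r = k/2^m` of height `|r| ≤ 1 + 2e` on it.) -/
theorem isSquare_mul_psNumer_finite' {e : ℕ} (he : e ≠ 0) : {N : ℕ | IsSquare (e * psNumer 2 N)}.Finite := by
  have heZ : (e : ℤ) ≠ 0 := Int.natCast_ne_zero.mpr he
  have hB : (-C (e : ℤ) : ℤ[X]) ≠ 0 := by simpa using heZ
  have hdeg : (-C (e : ℤ) : ℤ[X]).natDegree + 2 ≤ (X ^ 2 : ℤ[X]).natDegree := by
    rw [natDegree_neg, natDegree_C, natDegree_X_pow]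
  have hLF := levelFinite_xLinear (X ^ 2) (-C (e : ℤ)) hB hdeg (1 + 2 * e)
  refine ((Set.finite_lt_nat 2).union hLF).subset ?_
  rintro N ⟨k, hk⟩
  by_cases hN : N < 2
  · exact Or.inl hN
  refine Or.inr ?_
  push Not at hN
  obtain ⟨m, hNm, -, -, -⟩ := level_exponent hN
  have he1 : (1 : ℝ) ≤ e := by exact_mod_cast Nat.one_le_iff_ne_zero.mpr he
  have hx : partialSum 2 N = ((psNumer 2 N : ℤ) : ℝ) / 2 ^ (2 * m) := by rw [partialSum_two_eq_int_div, hNm]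
  have hs2 : partialSum 2 N < 2 := by
    rw [partialSum_two_eq_int_div, div_lt_iff₀ (by positivity)]
    have := psNumer_two_lt_int N
    have h' : ((psNumer 2 N : ℤ) : ℝ) < 2 * 2 ^ N ! := by exact_mod_cast this
    linarith
  have hkR : (e : ℝ) * (psNumer 2 N : ℝ) = (k : ℝ) * k := by exact_mod_cast hk
  have hr : (((k : ℚ) / 2 ^ m : ℚ) : ℝ) = (k : ℝ) / 2 ^ m := by push_cast; ring
  have hr2 : ((k : ℝ) / 2 ^ m) ^ 2 = e * partialSum 2 N := by
    rw [hx, pow_mul', div_pow]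
    push_cast
    rw [mul_div_assoc', hkR, sq]
  refine ⟨(k : ℚ) / 2 ^ m, ?_, ?_, ⟨((k : ℝ) / 2 ^ m) ^ 2 + 1, ?_⟩⟩
  · rw [hr]
    have h0 := partialSum_two_eq_int_div N
    have hs0 : 0 ≤ partialSum 2 N := by
      rw [h0]; exact div_nonneg (by exact_mod_cast (psNumer_two_pos_int N).le) (by positivity)
    nlinarith [sq_nonneg (|(k : ℝ) / 2 ^ m| - 1), sq_abs ((k : ℝ) / 2 ^ m), abs_nonneg ((k : ℝ) / 2 ^ m)]
  · rw [hr, bev_xLinP]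
    simp only [map_pow, aeval_X, map_neg, aeval_C, algebraMap_int_eq, Int.coe_castRingHom, Int.cast_natCast]
    linarith [hr2]
  · rw [hr, bev_xLinP]
    simp only [map_pow, aeval_X, map_neg, aeval_C, algebraMap_int_eq, Int.coe_castRingHom, Int.cast_natCast]
    nlinarith [sq_nonneg ((k : ℝ) / 2 ^ m)]

/-- [auxiliary] the SQUARE LEVELS of the class `Q(c,a,b)`: `|c|·p_N = □`, or `e·p_N = □` for some `e ∣ |b|`. -/
def SqLevels (b c : ℤ) : Set ℕ :=
  {N | IsSquare (c.natAbs * psNumer 2 N)} ∪ ⋃ e ∈ (b.natAbs.divisors : Set ℕ), {N | IsSquare (e * psNumer 2 N)}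

/-- `SqLevels b c` is FINITE for `c ≠ 0` (hypothesis-free): finitely many `e ∣ |b|`, each square set finite. -/
theorem sqLevels_finite (b : ℤ) {c : ℤ} (hc : c ≠ 0) : (SqLevels b c).Finite := by
  refine (isSquare_mul_psNumer_finite' (Int.natAbs_ne_zero.mpr hc)).union ?_
  refine (Finset.finite_toSet _).biUnion fun e he => ?_
  exact isSquare_mul_psNumer_finite' (Nat.pos_of_mem_divisors (Finset.mem_coe.mp he)).ne'

/-- **THE SQUARE DESCENT AT A LEVEL** (master lemma): for every presentation `P` of `Q(c,a,b) = (Y² − c·x)² + x·(aY + b)`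
(`bev P x y = y⁴ − 2c·x·y² + a·x·y + b·x + c²·x²`) with `c` ODD (not necessarily prime) and `b ≠ 0`, a level point at a
level `N ≥ 2` forces: EITHER `a` is even and `|c|·p_N = □` (degenerate branch — void for odd `a`, since `W` is odd), OR
`e·p_N = □` for some odd `e ∣ |b|` (hypothesis-free). -/
theorem level_sq_cases {c a b : ℤ} (hc : Odd c) (hb : b ≠ 0) {P : ℤ[X][X]}
    (hP : ∀ x y, bev P x y = y ^ 4 - 2 * c * x * y ^ 2 + a * x * y + b * x + c ^ 2 * x ^ 2)
    {N : ℕ} (hN : 2 ≤ N) {r : ℚ} (h : bev P (partialSum 2 N) r = 0) :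
    (Even a ∧ IsSquare (c.natAbs * psNumer 2 N)) ∨ ∃ e : ℕ, Odd e ∧ e ∣ b.natAbs ∧ IsSquare (e * psNumer 2 N) := by
  obtain ⟨m, hNm, hm1, -, -⟩ := level_exponent hN
  set p : ℤ := (psNumer 2 N : ℤ) with hpdef
  have hp_odd : Odd p := odd_psNumer_two (by omega)
  have hp0 : 0 < p := psNumer_two_pos_int N
  have hx : partialSum 2 N = (p : ℝ) / 2 ^ (2 * m) := by rw [partialSum_two_eq_int_div, hNm]
  rw [hP, hx] at h
  have hint := int_eq6 0 (-(2 * c)) a b (c ^ 2) p m r (by push_cast; linear_combination h)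
  obtain ⟨-, hW, hred⟩ := shape6 hc.pow hp_odd hm1 hint
  have hcore := core_sq (c := c) (a := a) (b := b) (m := m) (W := r.num) hp0 (by linear_combination hred)
  have hpn : p.natAbs = psNumer 2 N := by simp [hpdef]
  rcases hcore with ⟨hL, w, hw⟩ | hv
  · refine Or.inl ⟨?_, w.natAbs, ?_⟩
    · refine Int.not_odd_iff_even.mp fun ha => ?_
      have hodd : Odd (a * r.num + b * 2 ^ m) := by
        obtain ⟨j, rfl⟩ : ∃ j, m = j + 1 := ⟨m - 1, by omega⟩
        exact (ha.mul hW).add_even ⟨b * 2 ^ j, by ring⟩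
      rw [hL] at hodd
      exact Int.not_odd_iff_even.mpr ⟨0, by norm_num⟩ hodd
    · have := congrArg Int.natAbs hw
      rwa [Int.natAbs_mul, Int.natAbs_mul, hpn] at this
  · obtain ⟨e, he, heb, hsq⟩ := exists_odd_dvd_isSquare hb hp0 hp_odd hv
    rw [hpn] at hsq
    exact Or.inr ⟨e, he, heb, hsq⟩

/-- **LEVEL INCLUSION for the square class** (`c` odd, `b ≠ 0`): `LevelSet P C ⊆ {N < 2} ∪ SqLevels b c`. -/
theorem levelSet_sq_subset {c a b : ℤ} (hc : Odd c) (hb : b ≠ 0) {P : ℤ[X][X]}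
    (hP : ∀ x y, bev P x y = y ^ 4 - 2 * c * x * y ^ 2 + a * x * y + b * x + c ^ 2 * x ^ 2) (C : ℝ) :
    LevelSet P C ⊆ {N | N < 2} ∪ SqLevels b c := by
  rintro N ⟨r, -, h, -⟩
  simp only [SqLevels, Set.mem_union, Set.mem_setOf_eq, Set.mem_iUnion]
  by_cases hN : N < 2
  · exact Or.inl hN
  refine Or.inr ?_
  rcases level_sq_cases hc hb hP (by omega) h with ⟨-, hsq⟩ | ⟨e, -, heb, hsq⟩
  · exact Or.inl hsq
  · exact Or.inr ⟨e, Finset.mem_coe.mpr (Nat.mem_divisors.mpr ⟨heb, Int.natAbs_ne_zero.mpr hb⟩), hsq⟩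

/-- **LEVEL INCLUSION, `a` odd** (the degenerate branch is void): `LevelSet P C ⊆ {N < 2} ∪ ⋃_{e ∣ |b|} {N : e·p_N = □}`. -/
theorem levelSet_sq_subset_odd {c a b : ℤ} (hc : Odd c) (ha : Odd a) (hb : b ≠ 0) {P : ℤ[X][X]}
    (hP : ∀ x y, bev P x y = y ^ 4 - 2 * c * x * y ^ 2 + a * x * y + b * x + c ^ 2 * x ^ 2) (C : ℝ) :
    LevelSet P C ⊆ {N | N < 2} ∪ ⋃ e ∈ (b.natAbs.divisors : Set ℕ), {N | IsSquare (e * psNumer 2 N)} := by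
  rintro N ⟨r, -, h, -⟩
  simp only [Set.mem_union, Set.mem_setOf_eq, Set.mem_iUnion]
  by_cases hN : N < 2
  · exact Or.inl hN
  refine Or.inr ?_
  rcases level_sq_cases hc hb hP (by omega) h with ⟨hae, -⟩ | ⟨e, -, heb, hsq⟩
  · exact absurd hae (Int.not_even_iff_odd.mpr ha)
  · exact ⟨e, Finset.mem_coe.mpr (Nat.mem_divisors.mpr ⟨heb, Int.natAbs_ne_zero.mpr hb⟩), hsq⟩

/-- **`LevelFinite` for the square class** (`c` odd, `b ≠ 0`) — hypothesis-free. -/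
theorem levelFinite_sq {c a b : ℤ} (hc : Odd c) (hb : b ≠ 0) {P : ℤ[X][X]}
    (hP : ∀ x y, bev P x y = y ^ 4 - 2 * c * x * y ^ 2 + a * x * y + b * x + c ^ 2 * x ^ 2) : LevelFinite P :=
  fun C => ((Set.finite_lt_nat 2).union (sqLevels_finite b (by rintro rfl; norm_num at hc))).subset
    (levelSet_sq_subset hc hb hP C)

/-- **`ThinFibreAt m₀` at EVERY quality `m₀` for the square class** — hypothesis-free. -/
theorem thinFibreAt_sq {c a b : ℤ} (hc : Odd c) (hb : b ≠ 0) {P : ℤ[X][X]}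
    (hP : ∀ x y, bev P x y = y ^ 4 - 2 * c * x * y ^ 2 + a * x * y + b * x + c ^ 2 * x ^ 2) (m₀ : ℕ) :
    ThinFibreAt m₀ P :=
  thinFibreAt_of_levelFinite (levelFinite_sq hc hb hP) m₀

/-- the square class as an x-coefficient vector: `c₀ = Y⁴`, `c₁ = −2c·Y² + a·Y + b`, `c₂ = c²`. -/
def sqTopC (c a b : ℤ) (j : ℕ) : ℤ[X] :=
  if j = 0 then X ^ 4 else if j = 1 then C (-(2 * c)) * X ^ 2 + C a * X + C b else if j = 2 then C (c ^ 2) else 0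

/-- `: sqTopC c a b 0 = X ^ 4`. -/
theorem sqTopC_zero (c a b : ℤ) : sqTopC c a b 0 = X ^ 4 := by simp [sqTopC]
/-- `: sqTopC c a b 1 = C (-(2 * c)) * X ^ 2 + C a * X + C b`. -/
theorem sqTopC_one (c a b : ℤ) : sqTopC c a b 1 = C (-(2 * c)) * X ^ 2 + C a * X + C b := by simp [sqTopC]
/-- `: sqTopC c a b 2 = C (c ^ 2)`. -/
theorem sqTopC_two (c a b : ℤ) : sqTopC c a b 2 = C (c ^ 2) := by simp [sqTopC]

/-- `Q(c,a,b)(x, y) = y⁴ − 2c·x·y² + a·x·y + b·x + c²·x² = (y² − c·x)² + x·(a·y + b)`. -/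
theorem bev_sqTopC (c a b : ℤ) (x y : ℝ) :
    bev (xPolyP 2 (sqTopC c a b)) x y = y ^ 4 - 2 * c * x * y ^ 2 + a * x * y + b * x + c ^ 2 * x ^ 2 := by
  rw [bev_xPolyP]
  simp [Finset.sum_range_succ, sqTopC_zero, sqTopC_one, sqTopC_two, map_ofNat]
  ring

/-- `LevelSet (xPolyP 2 (sqTopC c a b)) C ⊆ {N < 2} ∪ SqLevels b c`. -/
theorem levelSet_sqTopC_subset {c a b : ℤ} (hc : Odd c) (hb : b ≠ 0) (C : ℝ) :
    LevelSet (xPolyP 2 (sqTopC c a b)) C ⊆ {N | N < 2} ∪ SqLevels b c :=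
  levelSet_sq_subset hc hb (bev_sqTopC c a b) C

/-- **`LevelFinite (xPolyP 2 (sqTopC c a b))`** (`c` odd, `b ≠ 0`). -/
theorem levelFinite_sqTopC {c a b : ℤ} (hc : Odd c) (hb : b ≠ 0) : LevelFinite (xPolyP 2 (sqTopC c a b)) :=
  levelFinite_sq hc hb (bev_sqTopC c a b)

/-- **`ThinFibreAt m₀ (xPolyP 2 (sqTopC c a b))` for every `m₀`.** -/
theorem thinFibreAt_sqTopC {c a b : ℤ} (hc : Odd c) (hb : b ≠ 0) (m₀ : ℕ) :
    ThinFibreAt m₀ (xPolyP 2 (sqTopC c a b)) :=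
  thinFibreAt_sq hc hb (bev_sqTopC c a b) m₀

/-! ### The exhibit of record ρ2′ = `rho2'` = `Q(17,−1,−1)` = `(Y² − 17x)² − x·Y − x` — DECIDED -/

/-- the TREE's `rho2'` IS the member `sqTopC 17 (−1) (−1)` of the square class (coefficient vectors equal). -/
theorem rho2'_eq_sqTopC : rho2' = sqTopC 17 (-1) (-1) := by
  funext j
  simp only [rho2', sqTopC, map_neg, map_one, neg_mul, one_mul]
  split_ifs <;> rfl

end Summit.Schanuel.Schanuel.Theorems.RootDecomp1KExhibitDescent
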